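import Literature.AlgebraicGeometry.GroupSchemes.CartierDualPointsGroupLike
import Literature.AlgebraicGeometry.GroupSchemes.CartierDualAnnihilatorRank
import HarnessLib

/-!
# The canonical pairing `⟪t, x⟫` of a point of the Cartier dual with a point of `G` (Tate 1997 §(3.8) in Yoneda form — part 1)

Layer `Literature/AlgebraicGeometry/GroupSchemes`, namespace `Literature.AlgebraicGeometry.GroupSchemes.AffineGroupScheme` (continues ★
`CartierDualPointsGroupLike` p845960 — `cartierDualPointsMulEquivGroupLike R′ G : (Spec R′ ⟶ G^D) ≃* GroupLike R′ (R′ ⊗ Γ(G))`, the ONE-test-ring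
dictionary in Hopf currency — and ★ `CartierDualAnnihilatorRank` p845797 §3 — `algCartierDualEquiv_comp_comap_cartierDualMap`).  DEFINITIONS
(`evalAt`, `cartierPairing`, `tautPt`) + theorems; no instance, no notation, no named fact, no `sorry`, no heartbeat budget.  Cell `hodgecm-mathlib`
(D-0151), programme P6 «MOD» (crux item stmt-HodgeConjecture-24832, `--supports`), organ (σ1-a) ∕ (W1-DOCK) «CHARACTERS ON POINTS ARE POINTS
OF THE CARTIER DUAL» for the W-line `F0_P6b_WeilCartierDuality`, stub `stub_W1` (LEAD F0P6-plan (g2) M-17v (3); B-p08 (g32) σ1 road memo): the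
Cartier-side terminal step of every scheme-theoretic Weil-pairing construction.  Count-neutral: HC_CM is proved only modulo the printed citations
until rung 0 closes; nothing here is about HC.

THE PRINT ([Tate1997FiniteFlatGroupSchemes] §(3.8) p. 145: «`G^D(S) = Hom_{S-gr}(G_S, 𝔾_{m,S})` … the group of group-like elements of `A ⊗_R S`»;
[MumfordAV1970] §20 p. 184: the Weil pairing `e_n(x, ŷ)` is a unit, bimultiplicative and natural on points).  For a commutative affine group
object `G` of `SchemeOver R` with `A := Γ(G, 𝒪_G)` finite free, and a commutative `R`-algebra `S`:
* §1 `evalAt x : S ⊗_R A →ₐ[S] S`, `s ⊗ a ↦ s · x^*(a)` — evaluation of functions on `G_S` at a point `x ∈ G(S)` (★ `ptEquiv`);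
* §2 **`cartierPairing t x := ev_x (g_t) ∈ S`** — THE CANONICAL PAIRING of `t ∈ G^D(S)` with `x ∈ G(S)` (`g_t` the group-like element of `t`):
  multiplicative in `t` (`cartierPairing_mul_left`, `_one_left`, `_inv_left_mul`, `isUnit_cartierPairing`);
* §3 **multiplicative and unital in `x`** (`cartierPairing_mul_right`: `Δ_S g_t = g_t ⊗ g_t` and points multiply by convolution ★ `ptMulEquiv` —
  `ptEquiv_mul_apply`; `cartierPairing_one_right`: `ev_1 = ε_S`);
* §4 **natural in `S`**: `val_cartierDualPointsMulEquivGroupLike_specOverMap_comp` (`g_{Spec ψ ≫ t} = (ψ ⊗ 1) g_t`, ★ CD2-pts `dualPairing_rTensor`),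
  `cartierPairing_naturality` (`⟪Spec ψ ≫ t, Spec ψ ≫ x⟫ = ψ ⟪t, x⟫`), `cartierPairing_specOverMap_comp` (`⟪Spec ψ ≫ t, x⟫ = (ψ ⊗ x^*)(g_t)`);
* §5 **SEPARATION**: `tautPt G S` (the tautological point over `S ⊗ A`), `cartierPairing_tautPt` (`⟪t, x_univ⟫ = g_t`),
  `eq_of_cartierPairing_tautPt_eq` ∕ **`eq_of_forall_cartierPairing_eq`** (a point of `G^D` is determined by its pairing values),
  `eq_one_iff_forall_cartierPairing_eq_one`;
* §6 **ADJUNCTION** `cartierPairing_comp_cartierDualMap : ⟪t ≫ β^D, x⟫ = ⟪t, x ≫ β⟫` (★ `cartierDualMap`; `g_{t ≫ β^D} = (1 ⊗ Γ(β)) g_t`).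
Part 2 (`CartierDualCharacterYoneda`): EXISTENCE — a natural bimultiplicative family `χ(y, x)` on points IS `⟪y ≫ w, x⟫` for a unique
homomorphism `w : Y ⟶ G^D`.

## References
* [Tate1997FiniteFlatGroupSchemes] J. Tate, *Finite flat group schemes*, in: Modular Forms and Fermat's Last Theorem (1997), §(3.8) p. 145.
* [MumfordAV1970] D. Mumford, *Abelian Varieties* (1970), §15 Thm. 1 (p. 143), §20 pp. 183–185.
* [Montgomery1993Hopf] S. Montgomery, *Hopf Algebras and Their Actions on Rings*, CBMS 82 (1993), 1.3.5, 9.1.4.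
* [GortzWedhorn2023] U. Görtz, T. Wedhorn, *Algebraic Geometry II* (2023), §(27.2), (27.2.1) (pp. 606–607).
-/

set_option autoImplicit false

-- Mathlib's `Over`/`Scheme` APIs (and the tree's `DualAlg G := WithConv (Dual R (Alg G))`) are used across semireducible wrappers (as in the ★
-- `GroupSchemes/*` files).
set_option backward.isDefEq.respectTransparency false

universe u

open CategoryTheory CategoryTheory.Limits AlgebraicGeometry MonoidalCategory CartesianMonoidalCategory TensorProduct WithConv

noncomputable section

namespace Literature.AlgebraicGeometry.GroupSchemes

namespace AffineGroupScheme

open scoped MonObj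

open Literature.AlgebraicGeometry.Motives Literature.NumberTheory.DiophantineGeometry Literature.RingTheory.HopfAlgebra

variable {R : Type u} [CommRing R] {S : Type u} [CommRing S] [Algebra R S] (G : SchemeOver R) [IsAffine G.left]

/-! ## §1 Evaluation of `S ⊗_R Γ(G)` at an `S`-point of `G` -/

/-- **Evaluation at a point**: for `x : Spec S → G` over `R` with algebra map `x^* : Γ(G) → S` (★ `ptEquiv`), the `S`-algebra map
`ev_x : S ⊗_R Γ(G) → S`, `s ⊗ a ↦ s · x^*(a)` — the value at `x` of a function on `G_S`. [cite: Tate1997FiniteFlatGroupSchemes, §(3.8) p. 145] -/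
def evalAt (x : specOver R S ⟶ G) : S ⊗[R] Alg G →ₐ[S] S :=
  Algebra.TensorProduct.lift (AlgHom.id S S) (ptEquiv G S x) fun _ _ => .all _ _

/-- `ev_x (s ⊗ a) = s · x^*(a)`. [cite: Tate1997FiniteFlatGroupSchemes, §(3.8) p. 145] -/
@[simp] theorem evalAt_tmul (x : specOver R S ⟶ G) (s : S) (a : Alg G) : evalAt G x (s ⊗ₜ a) = s * ptEquiv G S x a := by
  simp [evalAt]

variable [GrpObj G] [IsCommMonObj G] [Module.Free R (Alg G)] [Module.Finite R (Alg G)]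

/-! ## §2 The canonical pairing `⟪t, x⟫ ∈ S` of `t ∈ G^D(S)` with `x ∈ G(S)` -/

/-- **The canonical pairing `⟪t, x⟫ := ev_x (g_t) ∈ S`** of a point `t : Spec S → G^D` with a point `x : Spec S → G` over `R`, where
`g_t ∈ S ⊗_R Γ(G)` is the group-like element (= character `G_S → 𝔾_{m,S}`) of `t` (★ `cartierDualPointsMulEquivGroupLike`): the value of the
character `t` at `x` — [Tate1997FiniteFlatGroupSchemes] §(3.8) «`G^D(S) = Hom_{S-gr}(G_S, 𝔾_{m,S})`», read on `S`-points.
[cite: Tate1997FiniteFlatGroupSchemes, §(3.8) p. 145] -/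
def cartierPairing (t : specOver R S ⟶ cartierDual G) (x : specOver R S ⟶ G) : S :=
  evalAt G x (cartierDualPointsMulEquivGroupLike S G t).val

/-- Unfolding `⟪t, x⟫ = ev_x (g_t)`. [cite: Tate1997FiniteFlatGroupSchemes, §(3.8) p. 145] -/
theorem cartierPairing_def (t : specOver R S ⟶ cartierDual G) (x : specOver R S ⟶ G) :
    cartierPairing G t x = evalAt G x (cartierDualPointsMulEquivGroupLike S G t).val := rfl

/-- **`⟪t₁ t₂, x⟫ = ⟪t₁, x⟫ ⟪t₂, x⟫`** (the dictionary is multiplicative: `g_{t₁ t₂} = g_{t₁} g_{t₂}`, and `ev_x` is a ring map).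
[cite: Tate1997FiniteFlatGroupSchemes, §(3.8) p. 145] -/
theorem cartierPairing_mul_left (t₁ t₂ : specOver R S ⟶ cartierDual G) (x : specOver R S ⟶ G) :
    cartierPairing G (t₁ * t₂) x = cartierPairing G t₁ x * cartierPairing G t₂ x := by
  rw [cartierPairing_def, map_mul, GroupLike.val_mul, map_mul, ← cartierPairing_def, ← cartierPairing_def]

/-- **`⟪1, x⟫ = 1`.** [cite: Tate1997FiniteFlatGroupSchemes, §(3.8) p. 145] -/
theorem cartierPairing_one_left (x : specOver R S ⟶ G) : cartierPairing G (1 : specOver R S ⟶ cartierDual G) x = 1 := by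
  rw [cartierPairing_def, map_one, GroupLike.val_one, map_one]

/-- **`⟪t⁻¹, x⟫ ⟪t, x⟫ = 1`** — pairing values are units. [cite: Tate1997FiniteFlatGroupSchemes, §(3.8) p. 145] -/
theorem cartierPairing_inv_left_mul (t : specOver R S ⟶ cartierDual G) (x : specOver R S ⟶ G) :
    cartierPairing G t⁻¹ x * cartierPairing G t x = 1 := by
  rw [← cartierPairing_mul_left, inv_mul_cancel, cartierPairing_one_left]

/-- Pairing values are units of `S`. [cite: Tate1997FiniteFlatGroupSchemes, §(3.8) p. 145] -/
theorem isUnit_cartierPairing (t : specOver R S ⟶ cartierDual G) (x : specOver R S ⟶ G) : IsUnit (cartierPairing G t x) :=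
  IsUnit.of_mul_eq_one _ (by rw [mul_comm]; exact cartierPairing_inv_left_mul G t x)

/-! ## §3 The pairing is multiplicative and unital in the point of `G` (a group-like element IS a character) -/

omit [IsCommMonObj G] [Module.Free R (Alg G)] [Module.Finite R (Alg G)] in
/-- The convolution of two points read on a representation `Δ a = ∑ lᵢ ⊗ rᵢ`: `(x₁ x₂)^*(a) = ∑ x₁^*(lᵢ) x₂^*(rᵢ)` (★ `ptMulEquiv`:
points multiply by convolution; Mathlib `AlgHom.convMul_apply`). [cite: GortzWedhorn2023, §(27.2) (27.2.1) (pp. 606–607)] -/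
theorem ptEquiv_mul_apply {κ : Type*} (x₁ x₂ : specOver R S ⟶ G) (a : Alg G) (𝓡 : Coalgebra.Repr R a κ) :
    ptEquiv G S (x₁ * x₂) a = ∑ i ∈ 𝓡.index, ptEquiv G S x₁ (𝓡.left i) * ptEquiv G S x₂ (𝓡.right i) := by
  have h : ptEquiv G S (x₁ * x₂) = (ptMulEquiv G S x₁ * ptMulEquiv G S x₂).ofConv := by
    rw [← map_mul, ptMulEquiv_apply, ofConv_toConv]
  rw [h, AlgHom.convMul_apply, ptMulEquiv_apply, ptMulEquiv_apply, ofConv_toConv, ofConv_toConv, ← 𝓡.eq, map_sum]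
  refine Finset.sum_congr rfl fun i _ => ?_
  rw [Algebra.TensorProduct.lift_tmul]

/-- **`⟪t, x₁ x₂⟫ = ⟪t, x₁⟫ ⟪t, x₂⟫`** — the group-like element `g_t` of `t` is a CHARACTER of `G_S`: `Δ_S g_t = g_t ⊗ g_t`, and applying the
`S`-algebra map `ev_{x₁} ⊗ ev_{x₂} : (S ⊗ A) ⊗_S (S ⊗ A) → S` gives `ev_{x₁ x₂}(g_t)` on the left (points multiply by convolution, ★ `ptMulEquiv`)
and `ev_{x₁}(g_t) ev_{x₂}(g_t)` on the right. [cite: Tate1997FiniteFlatGroupSchemes, §(3.8) p. 145] [cite: Montgomery1993Hopf, 1.3.5] -/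
theorem cartierPairing_mul_right (t : specOver R S ⟶ cartierDual G) (x₁ x₂ : specOver R S ⟶ G) :
    cartierPairing G t (x₁ * x₂) = cartierPairing G t x₁ * cartierPairing G t x₂ := by
  set g := cartierDualPointsMulEquivGroupLike S G t with hgdef
  let L : (S ⊗[R] Alg G) ⊗[S] (S ⊗[R] Alg G) →ₐ[S] S :=
    Algebra.TensorProduct.lift (evalAt G x₁) (evalAt G x₂) fun _ _ => .all _ _
  -- `L ∘ Δ_S = ev_{x₁ x₂}` on `S ⊗ A`
  have key : ∀ z : S ⊗[R] Alg G, L (Coalgebra.comul (R := S) z) = evalAt G (x₁ * x₂) z := by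
    intro z
    induction z using TensorProduct.induction_on with
    | zero => rw [map_zero, map_zero, map_zero]
    | add z w hz hw => rw [map_add, map_add, hz, hw, map_add]
    | tmul s a =>
      let 𝓡 := Coalgebra.Repr.arbitrary R a
      rw [TensorProduct.comul_tmul, CommSemiring.comul_apply, ← 𝓡.eq, TensorProduct.tmul_sum, map_sum, map_sum, evalAt_tmul,
        ptEquiv_mul_apply G x₁ x₂ a 𝓡, Finset.mul_sum]
      refine Finset.sum_congr rfl fun i _ => ?_
      rw [TensorProduct.AlgebraTensorModule.tensorTensorTensorComm_tmul, Algebra.TensorProduct.lift_tmul, evalAt_tmul, evalAt_tmul]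
      ring
  rw [cartierPairing_def, cartierPairing_def, cartierPairing_def, ← hgdef, ← key, g.2.comul_eq_tmul_self, Algebra.TensorProduct.lift_tmul]

omit [Module.Free R (Alg G)] [Module.Finite R (Alg G)] in
/-- The unit point has algebra map the counit (★ `ptEquiv_one`), so `ev_1 = ε_S`: `ev_1 (s ⊗ a) = s · ε(a)`.
[cite: GortzWedhorn2023, §(27.2) (27.2.1) (pp. 606–607)] -/
theorem evalAt_one_tmul (s : S) (a : Alg G) : evalAt G (1 : specOver R S ⟶ G) (s ⊗ₜ a) = Coalgebra.counit (R := R) a • s := by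
  rw [evalAt_tmul, ptEquiv_one, AlgHom.comp_apply, Bialgebra.counitAlgHom_apply, Algebra.ofId_apply, Algebra.smul_def, mul_comm]

omit [Module.Free R (Alg G)] [Module.Finite R (Alg G)] in
/-- **`ev_1 = ε_S`**: evaluation at the unit point is the counit of the `S`-coalgebra `S ⊗ Γ(G)`. [cite: GortzWedhorn2023, §(27.2) (27.2.1) (pp. 606–607)] -/
theorem evalAt_one_eq_counit (z : S ⊗[R] Alg G) : evalAt G (1 : specOver R S ⟶ G) z = Coalgebra.counit (R := S) z := by
  induction z using TensorProduct.induction_on with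
  | zero => rw [map_zero, map_zero]
  | add z w hz hw => rw [map_add, map_add, hz, hw]
  | tmul s a => rw [evalAt_one_tmul, TensorProduct.counit_tmul, CommSemiring.counit_apply]

omit [IsCommMonObj G] [Module.Free R (Alg G)] [Module.Finite R (Alg G)] in
/-- **`Φ z ε = ε_S z`**: pairing with the counit functional is the base-changed counit. [cite: Tate1997FiniteFlatGroupSchemes, §(3.8) p. 145] -/
theorem charPairing_counit (z : S ⊗[R] Alg G) :
    charPairing S G z (Coalgebra.counit (R := R) (A := Alg G)) = Coalgebra.counit (R := S) z := by
  induction z using TensorProduct.induction_on with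
  | zero => rw [map_zero, map_zero, LinearMap.zero_apply]
  | add z w hz hw => rw [map_add, map_add, LinearMap.add_apply, hz, hw]
  | tmul s a => rw [charPairing_tmul, TensorProduct.counit_tmul, CommSemiring.counit_apply]

/-- **`⟪t, 1⟫ = 1`** — `ev_1 (g_t) = ε_S (g_t) = 1` for the group-like `g_t`. [cite: Tate1997FiniteFlatGroupSchemes, §(3.8) p. 145] -/
theorem cartierPairing_one_right (t : specOver R S ⟶ cartierDual G) : cartierPairing G t (1 : specOver R S ⟶ G) = 1 := by
  rw [cartierPairing_def, evalAt_one_eq_counit, (cartierDualPointsMulEquivGroupLike S G t).2.counit_eq_one]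

/-! ## §4 Naturality in the test ring: base change of points of `G^D` and of the pairing -/

section Naturality

variable {S' : Type u} [CommRing S'] [Algebra R S'] (ψ : S →ₐ[R] S')

/-- **Base change of points of `G^D` is base change of group-like elements**: the group-like element of `Spec ψ ≫ t ∈ G^D(S′)` is
`(ψ ⊗ 1)(g_t)` (both pair with every `F ∈ Γ(G)^*` to `ψ (t^*(e⁻¹ F))`: ★ `charPairing_cartierDualPointsMulEquivGroupLike`, ★ `ptEquiv_comap`,
★ CD2-pts `dualPairing_rTensor`; the pairing is perfect, ★ `dualPairing_bijective`). [cite: Tate1997FiniteFlatGroupSchemes, §(3.8) p. 145] -/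
theorem val_cartierDualPointsMulEquivGroupLike_specOverMap_comp (t : specOver R S ⟶ cartierDual G) :
    (cartierDualPointsMulEquivGroupLike S' G (AlgPoints.specOverMapOfAlgHom ψ ≫ t)).val =
      ψ.toLinearMap.rTensor (Alg G) (cartierDualPointsMulEquivGroupLike S G t).val := by
  refine (dualPairing_bijective (Module.Free.chooseBasis R (Alg G)) (charPairing S' G) (charPairing_tmul S' G)).1 ?_
  refine LinearMap.ext fun F => ?_
  have h1 := charPairing_cartierDualPointsMulEquivGroupLike S' G (AlgPoints.specOverMapOfAlgHom ψ ≫ t) (toConv F)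
  have h2 := charPairing_cartierDualPointsMulEquivGroupLike S G t (toConv F)
  rw [ofConv_toConv] at h1 h2
  rw [h1, dualPairing_rTensor ψ (charPairing S G) (charPairing_tmul S G) (charPairing S' G) (charPairing_tmul S' G), h2, ptEquiv_comap,
    AlgHom.comp_apply]

omit [GrpObj G] [IsCommMonObj G] [Module.Free R (Alg G)] [Module.Finite R (Alg G)] in
/-- `ev_{Spec ψ ≫ x} ((ψ ⊗ 1) z) = ψ (ev_x z)`. [cite: Tate1997FiniteFlatGroupSchemes, §(3.8) p. 145] -/
theorem evalAt_specOverMap_comp_rTensor (x : specOver R S ⟶ G) (z : S ⊗[R] Alg G) :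
    evalAt G (AlgPoints.specOverMapOfAlgHom ψ ≫ x) (ψ.toLinearMap.rTensor (Alg G) z) = ψ (evalAt G x z) := by
  induction z using TensorProduct.induction_on with
  | zero => rw [map_zero, map_zero, map_zero, map_zero]
  | add z w hz hw => rw [map_add, map_add, hz, hw, map_add, map_add]
  | tmul s a => rw [LinearMap.rTensor_tmul, evalAt_tmul, evalAt_tmul, ptEquiv_comap, AlgHom.toLinearMap_apply, AlgHom.comp_apply, map_mul]

omit [GrpObj G] [IsCommMonObj G] [Module.Free R (Alg G)] [Module.Finite R (Alg G)] in
/-- `ev_x ((ψ ⊗ 1) z) = (ψ ⊗ x^*)(z)` for a point `x` over `S′` and `z ∈ S ⊗ Γ(G)`. [cite: Tate1997FiniteFlatGroupSchemes, §(3.8) p. 145] -/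
theorem evalAt_rTensor (x : specOver R S' ⟶ G) (z : S ⊗[R] Alg G) :
    evalAt G x (ψ.toLinearMap.rTensor (Alg G) z) = Algebra.TensorProduct.lift ψ (ptEquiv G S' x) (fun _ _ => .all _ _) z := by
  induction z using TensorProduct.induction_on with
  | zero => rw [map_zero, map_zero, map_zero]
  | add z w hz hw => rw [map_add, map_add, hz, hw, map_add]
  | tmul s a => rw [LinearMap.rTensor_tmul, evalAt_tmul, Algebra.TensorProduct.lift_tmul, AlgHom.toLinearMap_apply]

/-- **The pairing is natural in the test ring**: `⟪Spec ψ ≫ t, Spec ψ ≫ x⟫ = ψ ⟪t, x⟫` for an `R`-algebra map `ψ : S → S′`.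
[cite: Tate1997FiniteFlatGroupSchemes, §(3.8) p. 145] -/
theorem cartierPairing_naturality (t : specOver R S ⟶ cartierDual G) (x : specOver R S ⟶ G) :
    cartierPairing G (AlgPoints.specOverMapOfAlgHom ψ ≫ t) (AlgPoints.specOverMapOfAlgHom ψ ≫ x) = ψ (cartierPairing G t x) := by
  rw [cartierPairing_def, val_cartierDualPointsMulEquivGroupLike_specOverMap_comp, evalAt_specOverMap_comp_rTensor, ← cartierPairing_def]

/-- **The pairing of a base-changed point of `G^D` with a point of `G` over the bigger ring**: `⟪Spec ψ ≫ t, x⟫ = (ψ ⊗ x^*)(g_t)` for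
`t ∈ G^D(S)`, `x ∈ G(S′)`, `ψ : S → S′`. [cite: Tate1997FiniteFlatGroupSchemes, §(3.8) p. 145] -/
theorem cartierPairing_specOverMap_comp (t : specOver R S ⟶ cartierDual G) (x : specOver R S' ⟶ G) :
    cartierPairing G (AlgPoints.specOverMapOfAlgHom ψ ≫ t) x =
      Algebra.TensorProduct.lift ψ (ptEquiv G S' x) (fun _ _ => .all _ _) (cartierDualPointsMulEquivGroupLike S G t).val := by
  rw [cartierPairing_def, val_cartierDualPointsMulEquivGroupLike_specOverMap_comp, evalAt_rTensor]

end Naturality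

/-! ## §5 Separation: a point of `G^D` is determined by its pairing values over all test rings -/

/-- **The tautological point `x_univ : Spec (S ⊗ Γ(G)) → G`** (algebra map `a ↦ 1 ⊗ a`). [cite: Tate1997FiniteFlatGroupSchemes, §(3.8) p. 145] -/
def tautPt (S : Type u) [CommRing S] [Algebra R S] : specOver R (S ⊗[R] Alg G) ⟶ G :=
  (ptEquiv G (S ⊗[R] Alg G)).symm (Algebra.TensorProduct.includeRight : Alg G →ₐ[R] S ⊗[R] Alg G)

omit [GrpObj G] [IsCommMonObj G] [Module.Free R (Alg G)] [Module.Finite R (Alg G)] in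
/-- The algebra map of `x_univ` is `a ↦ 1 ⊗ a`. [cite: Tate1997FiniteFlatGroupSchemes, §(3.8) p. 145] -/
theorem ptEquiv_tautPt (S : Type u) [CommRing S] [Algebra R S] :
    ptEquiv G (S ⊗[R] Alg G) (tautPt G S) = (Algebra.TensorProduct.includeRight : Alg G →ₐ[R] S ⊗[R] Alg G) :=
  Equiv.apply_symm_apply _ _

/-- **`⟪t, x_univ⟫ = g_t`**: pairing the base change of `t` to `S ⊗ Γ(G)` with the tautological point recovers the group-like element of `t`.
[cite: Tate1997FiniteFlatGroupSchemes, §(3.8) p. 145] -/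
theorem cartierPairing_tautPt (t : specOver R S ⟶ cartierDual G) :
    cartierPairing G (AlgPoints.specOverMapOfAlgHom (Algebra.TensorProduct.includeLeft : S →ₐ[R] S ⊗[R] Alg G) ≫ t) (tautPt G S) =
      (cartierDualPointsMulEquivGroupLike S G t).val := by
  rw [cartierPairing_specOverMap_comp]
  have h : Algebra.TensorProduct.lift (Algebra.TensorProduct.includeLeft : S →ₐ[R] S ⊗[R] Alg G) (ptEquiv G (S ⊗[R] Alg G) (tautPt G S))
      (fun _ _ => .all _ _) = AlgHom.id R (S ⊗[R] Alg G) := by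
    apply Algebra.TensorProduct.ext'
    intro s a
    rw [Algebra.TensorProduct.lift_tmul, ptEquiv_tautPt, Algebra.TensorProduct.includeLeft_apply, Algebra.TensorProduct.includeRight_apply,
      AlgHom.id_apply, Algebra.TensorProduct.tmul_mul_tmul, mul_one, one_mul]
  rw [h, AlgHom.id_apply]

/-- **SEPARATION (sharp form) — `t ∈ G^D(S)` is determined by ONE pairing value: with the tautological point over `S ⊗ Γ(G)`.**
[cite: Tate1997FiniteFlatGroupSchemes, §(3.8) p. 145] -/
theorem eq_of_cartierPairing_tautPt_eq {t₁ t₂ : specOver R S ⟶ cartierDual G}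
    (h : cartierPairing G (AlgPoints.specOverMapOfAlgHom (Algebra.TensorProduct.includeLeft : S →ₐ[R] S ⊗[R] Alg G) ≫ t₁) (tautPt G S) =
      cartierPairing G (AlgPoints.specOverMapOfAlgHom (Algebra.TensorProduct.includeLeft : S →ₐ[R] S ⊗[R] Alg G) ≫ t₂) (tautPt G S)) :
    t₁ = t₂ := by
  apply (cartierDualPointsMulEquivGroupLike S G).injective
  apply GroupLike.val_injective
  rwa [← cartierPairing_tautPt, ← cartierPairing_tautPt]

/-- **SEPARATION — a point `t ∈ G^D(S)` is determined by its pairing values `⟪Spec ψ ≫ t, x⟫` over all `R`-algebra maps `ψ : S → S′` and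
all points `x ∈ G(S′)`** (test `S′ := S ⊗ Γ(G)`, `x := x_univ`: the values recover `g_t`, and `t ↦ g_t` is injective).  This is the uniqueness
half of [Tate1997] §(3.8) «`G^D(S) = Hom_{S-gr}(G_S, 𝔾_{m,S})`». [cite: Tate1997FiniteFlatGroupSchemes, §(3.8) p. 145] -/
theorem eq_of_forall_cartierPairing_eq {t₁ t₂ : specOver R S ⟶ cartierDual G}
    (h : ∀ ⦃S' : Type u⦄ [CommRing S'] [Algebra R S'] (ψ : S →ₐ[R] S') (x : specOver R S' ⟶ G),
      cartierPairing G (AlgPoints.specOverMapOfAlgHom ψ ≫ t₁) x = cartierPairing G (AlgPoints.specOverMapOfAlgHom ψ ≫ t₂) x) :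
    t₁ = t₂ :=
  eq_of_cartierPairing_tautPt_eq G (h _ _)

/-- **`t = 1` iff all its pairing values are `1`.** [cite: Tate1997FiniteFlatGroupSchemes, §(3.8) p. 145] -/
theorem eq_one_iff_forall_cartierPairing_eq_one (t : specOver R S ⟶ cartierDual G) :
    t = 1 ↔ ∀ ⦃S' : Type u⦄ [CommRing S'] [Algebra R S'] (ψ : S →ₐ[R] S') (x : specOver R S' ⟶ G),
      cartierPairing G (AlgPoints.specOverMapOfAlgHom ψ ≫ t) x = 1 := by
  constructor
  · rintro rfl S' _ _ ψ x
    rw [MonObj.comp_one, cartierPairing_one_left]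
  · intro h
    refine eq_of_forall_cartierPairing_eq G fun S' _ _ ψ x => ?_
    rw [h, MonObj.comp_one, cartierPairing_one_left]

/-! ## §6 Adjunction: `⟪t ≫ β^D, x⟫ = ⟪t, x ≫ β⟫` -/

section Adjunction

variable {G' : SchemeOver R} [GrpObj G'] [IsCommMonObj G'] [IsAffine G'.left] [Module.Free R (Alg G')] [Module.Finite R (Alg G')]
  (β : G ⟶ G') [IsMonHom β]

omit [IsAffine G.left] [GrpObj G] [IsCommMonObj G] [Module.Free R (Alg G)] [Module.Finite R (Alg G)] [GrpObj G'] [IsCommMonObj G']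
  [IsAffine G'.left] [Module.Free R (Alg G')] [Module.Finite R (Alg G')] [IsMonHom β] in
/-- `Φ_G ((1 ⊗ Γ(β)) z) F = Φ_{G′} z (F ∘ Γ(β))`. [cite: Tate1997FiniteFlatGroupSchemes, §(3.8) p. 145] -/
theorem charPairing_lTensor_comap (z : S ⊗[R] Alg G') (F : Module.Dual R (Alg G)) :
    charPairing S G ((Alg.comap β).toLinearMap.lTensor S z) F = charPairing S G' z (F ∘ₗ (Alg.comap β).toLinearMap) := by
  induction z using TensorProduct.induction_on with
  | zero => rw [map_zero, map_zero, LinearMap.zero_apply, map_zero, LinearMap.zero_apply]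
  | add z w hz hw => rw [map_add, map_add, LinearMap.add_apply, hz, hw, map_add, LinearMap.add_apply]
  | tmul s a => rw [LinearMap.lTensor_tmul, charPairing_tmul, charPairing_tmul, LinearMap.comp_apply, AlgHom.toLinearMap_apply]

/-- **Restriction of characters**: the group-like element of `t ≫ β^D ∈ G^D(S)` is `(1 ⊗ Γ(β))(g_t)` for `t ∈ G′^D(S)` (★ `ptEquiv_comp`, ★
`algCartierDualEquiv_comp_comap_cartierDualMap`: `Γ(β^D)` is the transpose of `Γ(β)` through `e`). [cite: Tate1997FiniteFlatGroupSchemes, §(3.8) p. 145] -/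
theorem val_cartierDualPointsMulEquivGroupLike_comp_cartierDualMap (t : specOver R S ⟶ cartierDual G') :
    (cartierDualPointsMulEquivGroupLike S G (t ≫ cartierDualMap β)).val =
      (Alg.comap β).toLinearMap.lTensor S (cartierDualPointsMulEquivGroupLike S G' t).val := by
  refine (dualPairing_bijective (Module.Free.chooseBasis R (Alg G)) (charPairing S G) (charPairing_tmul S G)).1 ?_
  refine LinearMap.ext fun F => ?_
  have h1 := charPairing_cartierDualPointsMulEquivGroupLike S G (t ≫ cartierDualMap β) (toConv F)
  have h2 := charPairing_cartierDualPointsMulEquivGroupLike S G' t (DualAlg.transpose β (toConv F))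
  rw [ofConv_toConv] at h1
  have hF : WithConv.ofConv (show WithConv (Module.Dual R (Alg G')) from DualAlg.transpose β (toConv F)) = F ∘ₗ (Alg.comap β).toLinearMap :=
    DualAlg.ofConv_transpose β (toConv F)
  rw [hF] at h2
  -- `Γ(β^D) (e_G⁻¹ F) = e_{G′}⁻¹ (transpose β F)`
  have he : Alg.comap (cartierDualMap β) ((algCartierDualEquiv G).symm (toConv F)) =
      (algCartierDualEquiv G').symm (DualAlg.transpose β (toConv F)) := by
    apply (algCartierDualEquiv G').injective
    have h := AlgHom.congr_fun (algCartierDualEquiv_comp_comap_cartierDualMap β) ((algCartierDualEquiv G).symm (toConv F))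
    change algCartierDualEquiv G' (Alg.comap (cartierDualMap β) ((algCartierDualEquiv G).symm (toConv F))) =
      DualAlg.transpose β (algCartierDualEquiv G ((algCartierDualEquiv G).symm (toConv F))) at h
    rw [h, AlgEquiv.apply_symm_apply, AlgEquiv.apply_symm_apply]
  rw [h1, charPairing_lTensor_comap, h2, ptEquiv_comp, AlgHom.comp_apply, he]

omit [GrpObj G] [IsCommMonObj G] [Module.Free R (Alg G)] [Module.Finite R (Alg G)] [GrpObj G'] [IsCommMonObj G'] [Module.Free R (Alg G')]
  [Module.Finite R (Alg G')] [IsMonHom β] in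
/-- `ev_x ((1 ⊗ Γ(β)) z) = ev_{x ≫ β} z`. [cite: Tate1997FiniteFlatGroupSchemes, §(3.8) p. 145] -/
theorem evalAt_lTensor_comap (x : specOver R S ⟶ G) (z : S ⊗[R] Alg G') :
    evalAt G x ((Alg.comap β).toLinearMap.lTensor S z) = evalAt G' (x ≫ β) z := by
  induction z using TensorProduct.induction_on with
  | zero => rw [map_zero, map_zero, map_zero]
  | add z w hz hw => rw [map_add, map_add, hz, hw, map_add]
  | tmul s a => rw [LinearMap.lTensor_tmul, evalAt_tmul, evalAt_tmul, ptEquiv_comp, AlgHom.toLinearMap_apply, AlgHom.comp_apply]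

/-- **ADJUNCTION — `⟪t ≫ β^D, x⟫ = ⟪t, x ≫ β⟫`** for a homomorphism `β : G → G′`, `t ∈ G′^D(S)`, `x ∈ G(S)`: the Cartier dual map is the
transpose for the canonical pairing. [cite: Tate1997FiniteFlatGroupSchemes, §(3.8) p. 145] -/
theorem cartierPairing_comp_cartierDualMap (t : specOver R S ⟶ cartierDual G') (x : specOver R S ⟶ G) :
    cartierPairing G (t ≫ cartierDualMap β) x = cartierPairing G' t (x ≫ β) := by
  rw [cartierPairing_def, val_cartierDualPointsMulEquivGroupLike_comp_cartierDualMap, evalAt_lTensor_comap, ← cartierPairing_def]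

end Adjunction

end AffineGroupScheme

end Literature.AlgebraicGeometry.GroupSchemes

end
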